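import Literature.MathematicalPhysics.QuantumFieldTheory.Balaban1983to89.T3ExistSplit
import HarnessLib

/-!
# Route `UnitScaleTilt`, crux K1 child «MinimiserStabilityRegPr» (stmt-QuantumFields-19200), registered stub `stub_variational` of the layer-4
# v3d birth (511ba6194f4d04b9): THE STUB'S BODY FROM [Balaban1985Variational] THM 1 ∧ PROP 8 AT THE CARRIER (LQB, as printed) AND ATTAINMENT
# OVER (6)(ε₀) (located gap G-K1aR-2′) — the conditional reduction, constants merged, PROVED

Cell `ym3-torus` ∕ fleet seat `ym-ust-19200-p1` (HUMAN RULING D-0037, YM ladder rung R3).  WHAT THIS IS NOT: no clause of Bałaban's Theorem 1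
is proved here.  The registered stub reads `∀ L, ∃ a₀ a₁ B₃ B₄ > 0, MinSixAttainedAt L a₀ a₁ B₃ ∧ MinimisersIn8At L a₀ a₁ B₃ ∧
MinimiserCurvGradAt L a₀ a₁ B₃ B₄`; the tree already derives the second and third conjuncts BY NAME from the LQB lane's typed statements of
[Balaban1985Variational] at the d = 3 carrier (`T3Thm1Carrier.minimisersIn8At_of_prop8` ⇐ `B11.Prop8Printed`, `T3Thm1Carrier.minimiserCurvGradAt_of_thm1At`
⇐ `B11Thm1.Thm1At` + the unit-cube cover `1 ≤ M(ε₁)`), and the first conjunct is the located schema `T3ExistSplit.MinSixAttainedAt` (= the LQB lane's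
`hattain`; print: the expansion (142) p.299 with Sect. C's bounds over the whole chart).  This file MERGES THE CONSTANTS: the three inputs come with
different windows (`a₅` of Prop 8, Theorem 1's `a₁`, attainment's `â₀, â₁`) but one `B₃`, and all three schemas are antitone in `a₀, a₁`, so one
block `(a₀, a₁, B₃, B₄)` serves — **`stub_variational_body_of_printed`** (one `L`), **`stub_variational_of_printed`** (the registered shape, every
`L`, from the inputs at every admissible block size; `L ≤ 1` carries no family).  So the stub is, BY NAME, exactly
{`B11Thm1.Thm1At` at `T3Thm1Carrier.fam L` with `1 ≤ M(ε₁)`} ∧ {`B11.Prop8Printed C.B₃ (T3Thm1Carrier.famX L)`} ∧ {`MinSixAttainedAt L â₀ â₁ C.B₃`}.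

References: T. Bałaban, CMP 102 (1985) 277–309 [Balaban1985Variational] (Thm 1 (8)–(10) p.279, Prop 7 p.299, (142) p.299, Prop 8 p.304).
-/

noncomputable section

namespace Summit.QuantumFields.YangMills.Theorems.Variational

open Literature.MathematicalPhysics.QuantumFieldTheory.Balaban1983to89
open T3ContinuumYM3Torus T3LowerAlongMinimisersSplit T3AvgDivergenceSplit T3ExistSplit T3Thm1Carrier
open B11 (Prop8Printed)
open B11Thm1 (Thm1At)

/-! ## §1 The windows shrink freely -/

/-- `MinimisersIn8At` is antitone in `a₀` (only the window `ε₀ ≤ a₀` shrinks). [cite: Balaban1985Variational, Prop 8 p.304] -/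
theorem minimisersIn8At_anti_a₀ {L : ℕ} {a₀ a₀' a₁ B₃ : ℝ} (ha : a₀' ≤ a₀) (h : MinimisersIn8At L a₀ a₁ B₃) :
    MinimisersIn8At L a₀' a₁ B₃ :=
  fun F hF n K hnK ε₁ ε₀ hε₁ hε₁a hlo hhi V hV U hU hmin => h F hF n K hnK ε₁ ε₀ hε₁ hε₁a hlo (hhi.trans ha) V hV U hU hmin

/-- `MinimiserCurvGradAt` is antitone in `a₀`. [cite: Balaban1985Variational, Thm 1 (9)-(10) p.279] -/
theorem minimiserCurvGradAt_anti_a₀ {L : ℕ} {a₀ a₀' a₁ B₃ B₄ : ℝ} (ha : a₀' ≤ a₀) (h : MinimiserCurvGradAt L a₀ a₁ B₃ B₄) :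
    MinimiserCurvGradAt L a₀' a₁ B₃ B₄ :=
  fun F hF n K hnK ε₁ ε₀ hε₁ hε₁a hlo hhi V hV U hU hmin => h F hF n K hnK ε₁ ε₀ hε₁ hε₁a hlo (hhi.trans ha) V hV U hU hmin

/-! ## §2 The stub's body from the printed statements and attainment -/

/-- **`stub_variational`'s BODY AT ONE BLOCK SIZE `L` FROM [7] THM 1 ∧ PROP 8 AT THE CARRIERS ∧ ATTAINMENT OVER (6)(ε₀)**: Theorem 1 at constants
`C` for every member of the family of carriers (`T3Thm1Carrier.fam L`) with the unit-cube cover `1 ≤ M(ε₁)`, Proposition 8 at `C.B₃` over the family,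
and attainment of the infimum over print's regular fibre (6)(ε₀) at SOME window `(â₀, â₁)` and the same `B₃`, give one block of constants with
`MinSixAttainedAt ∧ MinimisersIn8At ∧ MinimiserCurvGradAt` — `a₀ = min a₅ â₀` (`a₅` of Prop 8), `a₁ = min (min C.a₁ (a₅/B₃)) â₁`, `B₃ = C.B₃`,
`B₄ = C.B₄`. [cite: Balaban1985Variational, Thm 1 (8)-(10) p.279 and Prop 8 p.304] -/
theorem stub_variational_body_of_printed {L : ℕ} (C : B11Thm1.Consts) (H : ∀ i : Idx L, Thm1At C (fam L i))
    (hM : ∀ ε₁ : ℝ, 0 < ε₁ → ε₁ ≤ C.a₁ → 1 ≤ C.Mfun ε₁) (H8 : Prop8Printed C.B₃ (famX L))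
    {â₀ â₁ : ℝ} (hâ₀ : 0 < â₀) (hâ₁ : 0 < â₁) (hatt : MinSixAttainedAt L â₀ â₁ C.B₃) :
    ∃ a₀ a₁ B₃ B₄ : ℝ, 0 < a₀ ∧ 0 < a₁ ∧ 0 < B₃ ∧ 0 < B₄ ∧
      MinSixAttainedAt L a₀ a₁ B₃ ∧ MinimisersIn8At L a₀ a₁ B₃ ∧ MinimiserCurvGradAt L a₀ a₁ B₃ B₄ := by
  obtain ⟨a₅, ha₅, h8⟩ := minimisersIn8At_of_prop8 C.B₃_pos H8
  -- Theorem 1's window intersected with Prop 8's: `a₁' := min C.a₁ (a₅/B₃)`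
  set a₁' : ℝ := min C.a₁ (a₅ / C.B₃) with ha₁'_def
  have ha₁' : 0 < a₁' := lt_min C.a₁_pos (div_pos ha₅ C.B₃_pos)
  have h8' : MinimisersIn8At L a₅ a₁' C.B₃ := h8 a₁'
  have hgrad := minimiserCurvGradAt_of_thm1At C H hM h8'
  have hmin_eq : min a₁' C.a₁ = a₁' := min_eq_left (min_le_left _ _)
  rw [hmin_eq] at hgrad
  -- the merged block
  refine ⟨min a₅ â₀, min a₁' â₁, C.B₃, C.B₄, lt_min ha₅ hâ₀, lt_min ha₁' hâ₁, C.B₃_pos, C.B₄_pos, ?_, ?_, ?_⟩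
  · exact minSixAttainedAt_mono (min_le_right _ _) (min_le_right _ _) le_rfl hatt
  · exact minimisersIn8At_anti_a₀ (min_le_left _ _) (minimisersIn8At_mono (min_le_left _ _) le_rfl h8')
  · exact minimiserCurvGradAt_anti_a₀ (min_le_left _ _) (minimiserCurvGradAt_mono (min_le_left _ _) le_rfl hgrad)

/-- **THE REGISTERED SHAPE OF `stub_variational` FROM THE PRINTED STATEMENTS AND ATTAINMENT AT EVERY ADMISSIBLE BLOCK SIZE**: if for every
`L > 1` there are Theorem 1's constants `C` with `Thm1At C` at every carrier of `T3Thm1Carrier.fam L`, the unit-cube cover, `Prop8Printed C.B₃` over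
`famX L`, and attainment over (6)(ε₀) at some window with the same `B₃`, then `∀ L, ∃ a₀ a₁ B₃ B₄ > 0, MinSixAttainedAt ∧ MinimisersIn8At ∧
MinimiserCurvGradAt` (block sizes `L ≤ 1` carry no member of the family — every clause is vacuous there).  This is the by-name socket: the stub
is exactly [Balaban1985Variational] Thm 1 ∧ Prop 8 for the (0.4)-averaging variational problem of the family plus the located attainment.
[cite: Balaban1985Variational, Thm 1 (8)-(10) p.279 and Prop 8 p.304] -/
theorem stub_variational_of_printed
    (hyp : ∀ L : ℕ, 1 < L → ∃ C : B11Thm1.Consts, (∀ i : Idx L, Thm1At C (fam L i)) ∧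
      (∀ ε₁ : ℝ, 0 < ε₁ → ε₁ ≤ C.a₁ → 1 ≤ C.Mfun ε₁) ∧ Prop8Printed C.B₃ (famX L) ∧
      ∃ â₀ â₁ : ℝ, 0 < â₀ ∧ 0 < â₁ ∧ MinSixAttainedAt L â₀ â₁ C.B₃) :
    ∀ (L : ℕ), ∃ a₀ a₁ B₃ B₄ : ℝ, 0 < a₀ ∧ 0 < a₁ ∧ 0 < B₃ ∧ 0 < B₄ ∧
      MinSixAttainedAt L a₀ a₁ B₃ ∧ MinimisersIn8At L a₀ a₁ B₃ ∧ MinimiserCurvGradAt L a₀ a₁ B₃ B₄ := by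
  intro L
  by_cases hL : 1 < L
  · obtain ⟨C, H, hM, H8, â₀, â₁, hâ₀, hâ₁, hatt⟩ := hyp L hL
    exact stub_variational_body_of_printed C H hM H8 hâ₀ hâ₁ hatt
  · refine ⟨1, 1, 1, 1, one_pos, one_pos, one_pos, one_pos, ?_, ?_, ?_⟩
    · exact fun F hFL => absurd (hFL ▸ F.hL.2) hL
    · exact fun F hFL => absurd (hFL ▸ F.hL.2) hL
    · exact fun F hFL => absurd (hFL ▸ F.hL.2) hL

end Summit.QuantumFields.YangMills.Theorems.Variational

end
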